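import Summits.QuantumFields.BalabanUV.T4Continuum.Support.SubstrateChartRealSlicePairSpecies
import Summits.QuantumFields.BalabanUV.T4Continuum.Support.CovariantVectorCovarianceDecayBlocks

/-!
# SUBSTRATE — [dict] D-8 ∕ LIBRARY L-E12c = W-17c (typer gen 9 RULING (λ20), journal l.18455; NE5 owner RULING R51 (2) l.18137 «currency condition»):
# THE DECAY-WEIGHTED CLOSED-DISC BOUNDS OF THE TWO RUNS' COVARIANCE ENTRIES ALONG ONE PAIR DISC — `CA := B_A·e^{−κ_A·D(bA, bA′)}`,
# `CB := B_B·e^{−κ_B·D(bB, bB′)}` with `D` the coarse sup-distance of the bond base points, `B_i = ‖s_i k_i‖·16|o|·(lev k_i)^{−d}·(8∕γ_i)·e^{2κ_i}`,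
# `κ_i = kappaF |o| d a′_i γ_i` (W-9c p229233 `entryDecay_covAtTLev_chart_on_ballExplicit` read at every point of the slice disc), the level-UNIFORM
# variant (bounded weights: ONE `B_i`, ONE `κ_i` for all levels) and the form AT THE SECTION OF RECORD

Cell `pub-balaban`, SUBSTRATE cell, seat `b2b-balaban-substrate-p1` (gen 4).  Summits-side under the LEAN PLACEMENT RULE.  Composition BY NAME, nothing restated,
0 `def`: W-17 `SubstrateChartRealSlicePair.hslice_chi₂_each` ∕ `pairPoint_sectionOfRecord_zero` (p228028), p223952 `analyticOnNhd_covAtTLev_printed_on_ballExplicit` ∕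
`rhoLev_pos`, W-9c (substrate-p3 g3) `CovariantVectorCovarianceDecayBlocks.entryDecay_covAtTLev_chart_on_ballExplicit(_uniform)` (p229233), p223342
`coercive_vecOp_towerDataOf_of_regular`, p217365 `transV_mem_unitaryGroup`, p225653 `sectionOfRecord_mem_unitaryLev₂`.

WHY (R51 (2), verbatim in substance).  On Road D the two-constants junction `operatorRate_complex_of_realSlice_each` is run PER ENTRY (`Op := ℂ`); its real-slice
rate `hreal` and the closed-disc bound of `hslice` must be stated in the SAME per-entry currency.  W-17b (p229325) supplies UNWEIGHTED bounds (`covBound`); this file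
supplies the DECAY-WEIGHTED ones for a consumer whose `hreal` is decay-weighted.  HONEST: the two runs carry DIFFERENT rates `κ_A ≠ κ_B` and different distances
(each on its own unit torus) in general, and the consumer's weight `e^{−(δ₀∕2)·dist}` is ITS letter — matching ∕ interpolating weights across profiles
(`w^{1−λ}·w′^{λ}`, R51 (2)) is the NE5 instancer's line, NOT claimed here; the Green twin (decay-weighted `greenT` along the slice, fine-lattice distance) is
W-17d ON REQUEST only (typer (λ20)).

HONEST FRAMING: rung (B)+1 of the FINITE-VOLUME T⁴ programme — NOT infinite volume, NOT a mass gap, NOT Clay; spine PROVED 0∕9; NE5 ∕ NE2 NOT PRINTED ∕ NOT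
proved.  Composition only, 0 estimate: the decay letters (`kappaF`, `16|o|`, `8∕γ`, `e^{2κ_F}` stencil-diameter loss) are p3's crude explicit counts for the
BACKGROUND-FIELD covariance species at MODEL level — NOT NE2's `pertCovC` letters (W-9c header, (λ16)(iii)); small-field letters and `0 < gammaV` at the record
are DISPLAYED; the ℰ-families' letter and `hreal` stay DISPLAYED (θ8).  HONEST DEPENDENCY (cell line, verbatim): continuum YM on T⁴ ⇐ BetaPertH ∧ nine spine
estimates (0/9 proved); BetaPertH ⇐ (D1) ∧ (D4) ∧ CAP+tail; G-an2-4 gates asym, D1 and NE2/3/4.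

WHAT ([folklore]; binders = W-17b's twelve + W-9c's torus-size letters `h2A h2B` (`2 ≤ fine (lev k) (unitMod P_i) μ` at every level)).
* §1 **`hslice_covAtTLev_pair₂_decay`** — the seven clauses at `𝒰 := TwoRunChart D o` for run A's covariance entry `(kA, tA, bA, bA′)` and run B's `(kB, tB, bB, bB′)`
  along ONE pair disc, closed-disc bounds `B_A(kA)·e^{−κ_A·ldist(bA.1.1, bA′.1.1)}` ∕ `B_B(kB)·e^{−κ_B·ldist(bB.1.1, bB′.1.1)}`, smallness per factor
  `(1 + r⁻¹)‖A.i‖ < rhoLev_i`; **`hslice_covAtTLev_pair₂_decay_uniform`** — bounded weights `‖s_i k‖ ≤ S_i` ⇒ `B_i := S_i·(16|o|)·(8∕γ_i)·e²` level-free.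
* §2 **`hslice_covAtTLev_pair₂_decay_sectionOfRecord`** — centre := `sectionOfRecord D ι U`, `A := 0` (`hR⁰∕hco∕hγ` discharged per run as in W-17b; rates
  `kappaF |o| d a′_i (gammaV_i)`).
-/

noncomputable section

open scoped BigOperators ComplexConjugate Matrix Matrix.Norms.L2Operator Kronecker ComplexOrder
open Complex (I)

namespace Summit.QuantumFields.BalabanUV.T4Continuum.SubstrateChartRealSlicePairSpeciesDecay

open Literature.MathematicalPhysics.QuantumFieldTheory.Balaban1983to89
open Literature.MathematicalPhysics.QuantumFieldTheory.Balaban1983to89.B5Prop11Plancherel (Tor fine)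
open Literature.MathematicalPhysics.QuantumFieldTheory.Balaban1983to89.B5G183RateUnitTower (lev lev_neZero)
open Literature.MathematicalPhysics.QuantumFieldTheory.Balaban1983to89.Beta.TorusG0Decay (ldist)
open Summit.QuantumFields.BalabanUV.T4Continuum
open Summit.QuantumFields.BalabanUV.T4Continuum.CoerciveInverseTower (Coercive)
open Summit.QuantumFields.BalabanUV.T4Continuum.CovariantVectorCoercive (vecOp gammaV)
open Summit.QuantumFields.BalabanUV.T4Continuum.CovariantBlockAveraging (ContourSystem transport)
open Summit.QuantumFields.BalabanUV.T4Continuum.CovariantVectorGreenDecayChartExplicit (kappaF)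
open Summit.QuantumFields.BalabanUV.T4Continuum.CovariantVectorCovarianceDecayBlocks (entryDecay_covAtTLev_chart_on_ballExplicit
  entryDecay_covAtTLev_chart_on_ballExplicit_uniform)
open Summit.QuantumFields.BalabanUV.T4Continuum.SubstrateBackgroundTransporters (unitMod transV_mem_unitaryGroup)
open Summit.QuantumFields.BalabanUV.T4Continuum.SubstrateTransporterSpecies
open Summit.QuantumFields.BalabanUV.T4Continuum.SubstrateTransporterSpeciesHolo (expChartT expChartInvT)
open Summit.QuantumFields.BalabanUV.T4Continuum.SubstrateTransporterSpeciesLev (cPr aPr covAtTLev coercive_vecOp_towerDataOf_of_regular)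
open Summit.QuantumFields.BalabanUV.T4Continuum.SubstrateTransporterSpeciesLevExplicit (rhoLev rhoLev_pos analyticOnNhd_covAtTLev_printed_on_ballExplicit)
open Summit.QuantumFields.BalabanUV.T4Continuum.SubstrateChartSection (chi sectionOfRecord TwoRunChart)
open Summit.QuantumFields.BalabanUV.T4Continuum.SubstrateChartRealSlice (unitaryLev₂ sectionOfRecord_mem_unitaryLev₂)
open Summit.QuantumFields.BalabanUV.T4Continuum.SubstrateChartRealSlicePair (pairPoint hslice_chi₂_each pairPoint_sectionOfRecord_zero)
open Summit.QuantumFields.BalabanUV.T4Continuum.SubstrateTwoRunsDriven (DrivenRuns)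

variable {G : Type} [GaugeGroup G] (D : DrivenRuns G) {o : Type} [Fintype o] [DecidableEq o] [Nonempty o]
variable (ΓA : (k : ℕ) → ContourSystem (D.F.P D.K).d (lev (D.F.P D.K).L k) (unitMod (D.F.P D.K)))
  (ΓB : (k : ℕ) → ContourSystem (D.F.P (D.K + 1)).d (lev (D.F.P (D.K + 1)).L k) (unitMod (D.F.P (D.K + 1))))

/-! ## §1 Decay-weighted bounds along ONE pair disc, generic centre -/

section Generic

variable {R₀ : TwoRunChart D o}
  (hR₀A : ∀ (k : Fin ((D.F.P D.K).K + 1)) ν i, R₀.1 k ν i ∈ Matrix.unitaryGroup o ℂ)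
  (hR₀B : ∀ (k : Fin ((D.F.P (D.K + 1)).K + 1)) ν i, R₀.2 k ν i ∈ Matrix.unitaryGroup o ℂ)
  {aA γA aB γB : ℝ} (haA : 0 ≤ aA) (haB : 0 ≤ aB)
  (hcoA : ∀ k : Fin ((D.F.P D.K).K + 1), Coercive γA (vecOp (lev (D.F.P D.K).L k) (unitMod (D.F.P D.K)) aA (ΓA k) (R₀.1 k)))
  (hcoB : ∀ k : Fin ((D.F.P (D.K + 1)).K + 1), Coercive γB (vecOp (lev (D.F.P (D.K + 1)).L k) (unitMod (D.F.P (D.K + 1))) aB (ΓB k) (R₀.2 k)))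
  (hγA : 0 < γA) (hγB : 0 < γB)
  {ℓA : Fin ((D.F.P D.K).K + 1) → ℕ} {ℓB : Fin ((D.F.P (D.K + 1)).K + 1) → ℕ}
  (hΓA : ∀ (k : Fin ((D.F.P D.K).K + 1)) y j μ (t : Fin (lev (D.F.P D.K).L k)), (ΓA k y j μ t).length ≤ ℓA k)
  (hΓB : ∀ (k : Fin ((D.F.P (D.K + 1)).K + 1)) y j μ (t : Fin (lev (D.F.P (D.K + 1)).L k)), (ΓB k y j μ t).length ≤ ℓB k)
  (hℓA : ∀ k : Fin ((D.F.P D.K).K + 1), (ℓA k : ℝ) ≤ (((D.F.P D.K).d : ℝ) + 1) * (lev (D.F.P D.K).L k : ℕ))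
  (hℓB : ∀ k : Fin ((D.F.P (D.K + 1)).K + 1), (ℓB k : ℝ) ≤ (((D.F.P (D.K + 1)).d : ℝ) + 1) * (lev (D.F.P (D.K + 1)).L k : ℕ))
  (h2A : ∀ (k : Fin ((D.F.P D.K).K + 1)) μ, 2 ≤ fine (lev (D.F.P D.K).L k) (unitMod (D.F.P D.K)) μ)
  (h2B : ∀ (k : Fin ((D.F.P (D.K + 1)).K + 1)) μ, 2 ≤ fine (lev (D.F.P (D.K + 1)).L k) (unitMod (D.F.P (D.K + 1))) μ)
  (sA sB : ℕ → ℂ)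

include hR₀A hR₀B haA haB hcoA hcoB hγA hγB hΓA hΓB hℓA hℓB h2A h2B in
/-- [folklore] **RUN A's AND RUN B's COVARIANCE ENTRIES ALONG ONE PAIR DISC WITH DECAY-WEIGHTED CLOSED-DISC BOUNDS — ALL SEVEN CLAUSES PROVED**: at the printed
letters of each run, for a centre with BOTH factors unitary and levelwise coercive, torus sizes `≥ 2`, a common depth `0 < r`, levels `kA kB : ℕ`, tags, bond pairs,
and a pair of coordinates with `(1 + r⁻¹)‖A.1‖ < rhoLev_A`, `(1 + r⁻¹)‖A.2‖ < rhoLev_B`: the closed-disc bounds are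
`‖s_A kA‖·16|o|·(lev kA)^{−d}·(8∕γ_A)·e^{2κ_A}·e^{−κ_A·ldist(bA.1.1, bA′.1.1)}` and the run-B analogue, `κ_i = kappaF |o| d a′_i γ_i`
(W-9c `entryDecay_covAtTLev_chart_on_ballExplicit` at every point of the slice disc, which lies in `ball 0 rhoLev_i`). -/
theorem hslice_covAtTLev_pair₂_decay {r : ℝ} (hr : 0 < r) (kA kB : ℕ) {TA TB : Type*} (tA : TA) (tB : TB)
    (bA bA' : (Tor (unitMod (D.F.P D.K)) × Fin (D.F.P D.K).d) × o) (bB bB' : (Tor (unitMod (D.F.P (D.K + 1))) × Fin (D.F.P (D.K + 1)).d) × o)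
    (A : TwoRunChart D o) (hA1 : (1 + r⁻¹) * ‖A.1‖ < rhoLev (D.F.P D.K) (o := o) γA aA)
    (hA2 : (1 + r⁻¹) * ‖A.2‖ < rhoLev (D.F.P (D.K + 1)) (o := o) γB aB) :
    ∃ γ : ℂ → TwoRunChart D o, ∃ z₀ : ℂ, ‖z₀‖ ≤ r ∧ γ z₀ = pairPoint D R₀ A ∧ (∀ x : ℝ, |x| < 1 → γ x ∈ unitaryLev₂ D) ∧
      DiffContOnCl ℂ (fun z => covAtTLev (D.F.P D.K) (cPr (D.F.P D.K)) (aPr (D.F.P D.K) aA) ΓA sA (chi _ (γ z).1).1 (chi _ (γ z).1).2 kA tA bA bA')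
        (Metric.ball (0 : ℂ) 1) ∧
      DiffContOnCl ℂ (fun z => covAtTLev (D.F.P (D.K + 1)) (cPr (D.F.P (D.K + 1))) (aPr (D.F.P (D.K + 1)) aB) ΓB sB (chi _ (γ z).2).1 (chi _ (γ z).2).2
        kB tB bB bB') (Metric.ball (0 : ℂ) 1) ∧
      (∀ z : ℂ, ‖z‖ ≤ 1 → ‖covAtTLev (D.F.P D.K) (cPr (D.F.P D.K)) (aPr (D.F.P D.K) aA) ΓA sA (chi _ (γ z).1).1 (chi _ (γ z).1).2 kA tA bA bA'‖
        ≤ (‖sA kA‖ * (16 * Fintype.card o * (((lev (D.F.P D.K).L kA : ℕ) : ℝ) ^ (D.F.P D.K).d)⁻¹) * (8 / γA) *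
            Real.exp (2 * kappaF (Fintype.card o) (D.F.P D.K).d aA γA)) *
          Real.exp (-(kappaF (Fintype.card o) (D.F.P D.K).d aA γA * ldist (unitMod (D.F.P D.K)) bA.1.1 bA'.1.1))) ∧
      ∀ z : ℂ, ‖z‖ ≤ 1 → ‖covAtTLev (D.F.P (D.K + 1)) (cPr (D.F.P (D.K + 1))) (aPr (D.F.P (D.K + 1)) aB) ΓB sB (chi _ (γ z).2).1 (chi _ (γ z).2).2
        kB tB bB bB'‖
        ≤ (‖sB kB‖ * (16 * Fintype.card o * (((lev (D.F.P (D.K + 1)).L kB : ℕ) : ℝ) ^ (D.F.P (D.K + 1)).d)⁻¹) * (8 / γB) *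
            Real.exp (2 * kappaF (Fintype.card o) (D.F.P (D.K + 1)).d aB γB)) *
          Real.exp (-(kappaF (Fintype.card o) (D.F.P (D.K + 1)).d aB γB * ldist (unitMod (D.F.P (D.K + 1))) bB.1.1 bB'.1.1)) :=
  hslice_chi₂_each D ⟨fun k ν i => hR₀A k ν i, fun k ν i => hR₀B k ν i⟩
    (fun RS => covAtTLev (D.F.P D.K) (cPr (D.F.P D.K)) (aPr (D.F.P D.K) aA) ΓA sA RS.1 RS.2 kA tA bA bA')
    (fun RS => covAtTLev (D.F.P (D.K + 1)) (cPr (D.F.P (D.K + 1))) (aPr (D.F.P (D.K + 1)) aB) ΓB sB RS.1 RS.2 kB tB bB bB') hr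
    (analyticOnNhd_covAtTLev_printed_on_ballExplicit _ ΓA hR₀A haA hcoA hγA hΓA hℓA sA kA tA bA bA')
    (fun _ hB => entryDecay_covAtTLev_chart_on_ballExplicit _ ΓA hR₀A haA hcoA hγA hΓA hℓA h2A sA kA tA hB bA bA')
    (analyticOnNhd_covAtTLev_printed_on_ballExplicit _ ΓB hR₀B haB hcoB hγB hΓB hℓB sB kB tB bB bB')
    (fun _ hB => entryDecay_covAtTLev_chart_on_ballExplicit _ ΓB hR₀B haB hcoB hγB hΓB hℓB h2B sB kB tB hB bB bB') A hA1 hA2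

include hR₀A hR₀B haA haB hcoA hcoB hγA hγB hΓA hΓB hℓA hℓB h2A h2B in
/-- [folklore] **THE LEVEL-UNIFORM VARIANT** (bounded weights `‖s_A k‖ ≤ S_A`, `‖s_B k‖ ≤ S_B`): closed-disc bounds `S_i·(16|o|)·(8∕γ_i)·e²·e^{−κ_i·D}` — ONE constant
and ONE rate per run for ALL levels (W-9c `entryDecay_covAtTLev_chart_on_ballExplicit_uniform`). -/
theorem hslice_covAtTLev_pair₂_decay_uniform {SA SB : ℝ} (hsA : ∀ k, ‖sA k‖ ≤ SA) (hsB : ∀ k, ‖sB k‖ ≤ SB) {r : ℝ} (hr : 0 < r) (kA kB : ℕ)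
    {TA TB : Type*} (tA : TA) (tB : TB)
    (bA bA' : (Tor (unitMod (D.F.P D.K)) × Fin (D.F.P D.K).d) × o) (bB bB' : (Tor (unitMod (D.F.P (D.K + 1))) × Fin (D.F.P (D.K + 1)).d) × o)
    (A : TwoRunChart D o) (hA1 : (1 + r⁻¹) * ‖A.1‖ < rhoLev (D.F.P D.K) (o := o) γA aA)
    (hA2 : (1 + r⁻¹) * ‖A.2‖ < rhoLev (D.F.P (D.K + 1)) (o := o) γB aB) :
    ∃ γ : ℂ → TwoRunChart D o, ∃ z₀ : ℂ, ‖z₀‖ ≤ r ∧ γ z₀ = pairPoint D R₀ A ∧ (∀ x : ℝ, |x| < 1 → γ x ∈ unitaryLev₂ D) ∧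
      DiffContOnCl ℂ (fun z => covAtTLev (D.F.P D.K) (cPr (D.F.P D.K)) (aPr (D.F.P D.K) aA) ΓA sA (chi _ (γ z).1).1 (chi _ (γ z).1).2 kA tA bA bA')
        (Metric.ball (0 : ℂ) 1) ∧
      DiffContOnCl ℂ (fun z => covAtTLev (D.F.P (D.K + 1)) (cPr (D.F.P (D.K + 1))) (aPr (D.F.P (D.K + 1)) aB) ΓB sB (chi _ (γ z).2).1 (chi _ (γ z).2).2
        kB tB bB bB') (Metric.ball (0 : ℂ) 1) ∧
      (∀ z : ℂ, ‖z‖ ≤ 1 → ‖covAtTLev (D.F.P D.K) (cPr (D.F.P D.K)) (aPr (D.F.P D.K) aA) ΓA sA (chi _ (γ z).1).1 (chi _ (γ z).1).2 kA tA bA bA'‖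
        ≤ (SA * (16 * Fintype.card o) * (8 / γA) * Real.exp 2) *
          Real.exp (-(kappaF (Fintype.card o) (D.F.P D.K).d aA γA * ldist (unitMod (D.F.P D.K)) bA.1.1 bA'.1.1))) ∧
      ∀ z : ℂ, ‖z‖ ≤ 1 → ‖covAtTLev (D.F.P (D.K + 1)) (cPr (D.F.P (D.K + 1))) (aPr (D.F.P (D.K + 1)) aB) ΓB sB (chi _ (γ z).2).1 (chi _ (γ z).2).2
        kB tB bB bB'‖
        ≤ (SB * (16 * Fintype.card o) * (8 / γB) * Real.exp 2) *
          Real.exp (-(kappaF (Fintype.card o) (D.F.P (D.K + 1)).d aB γB * ldist (unitMod (D.F.P (D.K + 1))) bB.1.1 bB'.1.1)) :=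
  hslice_chi₂_each D ⟨fun k ν i => hR₀A k ν i, fun k ν i => hR₀B k ν i⟩
    (fun RS => covAtTLev (D.F.P D.K) (cPr (D.F.P D.K)) (aPr (D.F.P D.K) aA) ΓA sA RS.1 RS.2 kA tA bA bA')
    (fun RS => covAtTLev (D.F.P (D.K + 1)) (cPr (D.F.P (D.K + 1))) (aPr (D.F.P (D.K + 1)) aB) ΓB sB RS.1 RS.2 kB tB bB bB') hr
    (analyticOnNhd_covAtTLev_printed_on_ballExplicit _ ΓA hR₀A haA hcoA hγA hΓA hℓA sA kA tA bA bA')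
    (fun _ hB => entryDecay_covAtTLev_chart_on_ballExplicit_uniform _ ΓA hR₀A haA hcoA hγA hΓA hℓA h2A sA hsA kA tA hB bA bA')
    (analyticOnNhd_covAtTLev_printed_on_ballExplicit _ ΓB hR₀B haB hcoB hγB hΓB hℓB sB kB tB bB bB')
    (fun _ hB => entryDecay_covAtTLev_chart_on_ballExplicit_uniform _ ΓB hR₀B haB hcoB hγB hΓB hℓB h2B sB hsB kB tB hB bB bB') A hA1 hA2

end Generic

/-! ## §2 At the section of record: centre = the section point, `A = 0` -/

section Record

variable (ι : G →* Matrix o o ℂ) (hι : ∀ g, ι g ∈ Matrix.unitaryGroup o ℂ) (hdist : ∀ g : G, ‖ι g - 1‖ = dist1 g) (U : D.carriers.BgB)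
  {aA αA τA aB αB τB : ℝ} (haA : 0 < aA) (hαA : 0 ≤ αA) (hτA : 0 ≤ τA) (haB : 0 < aB) (hαB : 0 ≤ αB) (hτB : 0 ≤ τB)
  (hUA : ∀ (k : Fin ((D.F.P D.K).K + 1)) (b : PBond (D.F.P D.K) ((D.F.P D.K).K - k)),
    ((lev (D.F.P D.K).L k : ℕ) : ℝ) * dist1 (Averaging.iter D.avA ((D.F.P D.K).K - k) (D.carriers.transport U).1 b) ≤ αA)
  (hTA : ∀ (k : Fin ((D.F.P D.K).K + 1)) y jj μ (t : Fin (lev (D.F.P D.K).L k)),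
    ‖transport (fine (lev (D.F.P D.K).L k) (unitMod (D.F.P D.K))) ((sectionOfRecord D ι U).1 k) μ (ΓA k y jj μ t) - 1‖ ≤ τA)
  (hUB : ∀ (k : Fin ((D.F.P (D.K + 1)).K + 1)) (b : PBond (D.F.P (D.K + 1)) ((D.F.P (D.K + 1)).K - k)),
    ((lev (D.F.P (D.K + 1)).L k : ℕ) : ℝ) * dist1 (Averaging.iter D.avB ((D.F.P (D.K + 1)).K - k) U.1 b) ≤ αB)
  (hTB : ∀ (k : Fin ((D.F.P (D.K + 1)).K + 1)) y jj μ (t : Fin (lev (D.F.P (D.K + 1)).L k)),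
    ‖transport (fine (lev (D.F.P (D.K + 1)).L k) (unitMod (D.F.P (D.K + 1)))) ((sectionOfRecord D ι U).2 k) μ (ΓB k y jj μ t) - 1‖ ≤ τB)
  (hγVA : 0 < gammaV (Fintype.card o) (D.F.P D.K).d aA αA τA) (hγVB : 0 < gammaV (Fintype.card o) (D.F.P (D.K + 1)).d aB αB τB)
  {ℓA : Fin ((D.F.P D.K).K + 1) → ℕ} {ℓB : Fin ((D.F.P (D.K + 1)).K + 1) → ℕ}
  (hΓA : ∀ (k : Fin ((D.F.P D.K).K + 1)) y j μ (t : Fin (lev (D.F.P D.K).L k)), (ΓA k y j μ t).length ≤ ℓA k)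
  (hΓB : ∀ (k : Fin ((D.F.P (D.K + 1)).K + 1)) y j μ (t : Fin (lev (D.F.P (D.K + 1)).L k)), (ΓB k y j μ t).length ≤ ℓB k)
  (hℓA : ∀ k : Fin ((D.F.P D.K).K + 1), (ℓA k : ℝ) ≤ (((D.F.P D.K).d : ℝ) + 1) * (lev (D.F.P D.K).L k : ℕ))
  (hℓB : ∀ k : Fin ((D.F.P (D.K + 1)).K + 1), (ℓB k : ℝ) ≤ (((D.F.P (D.K + 1)).d : ℝ) + 1) * (lev (D.F.P (D.K + 1)).L k : ℕ))
  (h2A : ∀ (k : Fin ((D.F.P D.K).K + 1)) μ, 2 ≤ fine (lev (D.F.P D.K).L k) (unitMod (D.F.P D.K)) μ)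
  (h2B : ∀ (k : Fin ((D.F.P (D.K + 1)).K + 1)) μ, 2 ≤ fine (lev (D.F.P (D.K + 1)).L k) (unitMod (D.F.P (D.K + 1))) μ)
  (sA sB : ℕ → ℂ)

include hι hdist haA hαA hτA haB hαB hτB hUA hTA hUB hTB hγVA hγVB hΓA hΓB hℓA hℓB h2A h2B in
/-- [folklore] **THE TWO RUNS' COVARIANCE ENTRIES ALONG ONE DISC THROUGH THE SECTION POINT, DECAY-WEIGHTED BOUNDS** (`hslice_covAtTLev_pair₂_decay` with centre :=
`sectionOfRecord D ι U` and `A := 0`; rates `κ_i = kappaF |o| d a′_i (gammaV_i)`; `hR⁰∕hco∕hγ` discharged per run by `transV_mem_unitaryGroup`,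
`coercive_vecOp_towerDataOf_of_regular`, `0 < gammaV`). -/
theorem hslice_covAtTLev_pair₂_decay_sectionOfRecord {r : ℝ} (hr : 0 < r) (kA kB : ℕ) {TA TB : Type*} (tA : TA) (tB : TB)
    (bA bA' : (Tor (unitMod (D.F.P D.K)) × Fin (D.F.P D.K).d) × o) (bB bB' : (Tor (unitMod (D.F.P (D.K + 1))) × Fin (D.F.P (D.K + 1)).d) × o) :
    ∃ γ : ℂ → TwoRunChart D o, ∃ z₀ : ℂ, ‖z₀‖ ≤ r ∧ γ z₀ = sectionOfRecord D ι U ∧ (∀ x : ℝ, |x| < 1 → γ x ∈ unitaryLev₂ D) ∧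
      DiffContOnCl ℂ (fun z => covAtTLev (D.F.P D.K) (cPr (D.F.P D.K)) (aPr (D.F.P D.K) aA) ΓA sA (chi _ (γ z).1).1 (chi _ (γ z).1).2 kA tA bA bA')
        (Metric.ball (0 : ℂ) 1) ∧
      DiffContOnCl ℂ (fun z => covAtTLev (D.F.P (D.K + 1)) (cPr (D.F.P (D.K + 1))) (aPr (D.F.P (D.K + 1)) aB) ΓB sB (chi _ (γ z).2).1 (chi _ (γ z).2).2
        kB tB bB bB') (Metric.ball (0 : ℂ) 1) ∧
      (∀ z : ℂ, ‖z‖ ≤ 1 → ‖covAtTLev (D.F.P D.K) (cPr (D.F.P D.K)) (aPr (D.F.P D.K) aA) ΓA sA (chi _ (γ z).1).1 (chi _ (γ z).1).2 kA tA bA bA'‖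
        ≤ (‖sA kA‖ * (16 * Fintype.card o * (((lev (D.F.P D.K).L kA : ℕ) : ℝ) ^ (D.F.P D.K).d)⁻¹) * (8 / gammaV (Fintype.card o) (D.F.P D.K).d aA αA τA) *
            Real.exp (2 * kappaF (Fintype.card o) (D.F.P D.K).d aA (gammaV (Fintype.card o) (D.F.P D.K).d aA αA τA))) *
          Real.exp (-(kappaF (Fintype.card o) (D.F.P D.K).d aA (gammaV (Fintype.card o) (D.F.P D.K).d aA αA τA) *
            ldist (unitMod (D.F.P D.K)) bA.1.1 bA'.1.1))) ∧
      ∀ z : ℂ, ‖z‖ ≤ 1 → ‖covAtTLev (D.F.P (D.K + 1)) (cPr (D.F.P (D.K + 1))) (aPr (D.F.P (D.K + 1)) aB) ΓB sB (chi _ (γ z).2).1 (chi _ (γ z).2).2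
        kB tB bB bB'‖
        ≤ (‖sB kB‖ * (16 * Fintype.card o * (((lev (D.F.P (D.K + 1)).L kB : ℕ) : ℝ) ^ (D.F.P (D.K + 1)).d)⁻¹) *
              (8 / gammaV (Fintype.card o) (D.F.P (D.K + 1)).d aB αB τB) *
            Real.exp (2 * kappaF (Fintype.card o) (D.F.P (D.K + 1)).d aB (gammaV (Fintype.card o) (D.F.P (D.K + 1)).d aB αB τB))) *
          Real.exp (-(kappaF (Fintype.card o) (D.F.P (D.K + 1)).d aB (gammaV (Fintype.card o) (D.F.P (D.K + 1)).d aB αB τB) *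
            ldist (unitMod (D.F.P (D.K + 1))) bB.1.1 bB'.1.1)) := by
  have h := hslice_covAtTLev_pair₂_decay D ΓA ΓB (R₀ := sectionOfRecord D ι U)
    (fun k ν i => transV_mem_unitaryGroup _ hι (Averaging.iter D.avA ((D.F.P D.K).K - k) (D.carriers.transport U).1) ν i)
    (fun k ν i => transV_mem_unitaryGroup _ hι (Averaging.iter D.avB ((D.F.P (D.K + 1)).K - k) U.1) ν i) haA.le haB.le
    (coercive_vecOp_towerDataOf_of_regular _ ΓA ι D.avA hdist (D.carriers.transport U).1 haA hαA hτA hUA hTA)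
    (coercive_vecOp_towerDataOf_of_regular _ ΓB ι D.avB hdist U.1 haB hαB hτB hUB hTB) hγVA hγVB hΓA hΓB hℓA hℓB h2A h2B sA sB hr kA kB tA tB
    bA bA' bB bB' 0
    (by rw [Prod.fst_zero, norm_zero, mul_zero]; exact rhoLev_pos _ haA.le hγVA)
    (by rw [Prod.snd_zero, norm_zero, mul_zero]; exact rhoLev_pos _ haB.le hγVB)
  rwa [pairPoint_sectionOfRecord_zero] at h

end Record

end Summit.QuantumFields.BalabanUV.T4Continuum.SubstrateChartRealSlicePairSpeciesDecay

end
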